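import Summits.SmoothPoincare4.SmoothPoincare4.Theorems.DottedCircleRasmussenDcrGapHelperFriendsCarrierTkAux4

/-!
# Helper `helper_friendsCarrier_Tk_coreDisc` of stub `helper_friendsCarrier_Tk` — part 3: the core disc and its collar germ
(item stmt-SmoothPoincare4-16128, route route-SmoothPoincare4-DottedCircleRasmussen)

Continuation of parts 1–2 (`…TkAux3`, `…TkAux4`: the relative open trace `TraceDatum.Trace` of the
model dotted handlebody with its charts `incl`, `inr`).  Here, following the tree's `OpenTrace.lean`
(`TubeNbhd.coreDisc`, `isSliceDiscIn`), the CORE-DISC clauses of `helper_friendsCarrier_Tk`: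

* `TraceDatum.coreDisc` — the core of the `2`-handle `x ↦ inr (x, 0)`: a smooth injective immersion
  `ℝ² → T`, equal to `incl ∘ K₀` on the unit circle (`K₀ = ν(·, 0)` the knot), running in the collar
  OUTSIDE `D_k` for `0 < ‖x‖ < 1` (`coreDisc x = incl (θ(s, K₀(x/‖x‖)))`, `s = δ(1 - ‖x‖)/(1 + ‖x‖) > 0`,
  and `θ(s, a) ∈ D_k ↔ s ≤ 0`), its centre on the cocore plane;
* `TraceDatum.collarGerm` — a smooth `g₀ : ℝ² → ℝ⁴` with `coreDisc = incl ∘ g₀` on the annulus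
  `3/4 < ‖x‖ ≤ 1` and `d/dρ G_k(g₀(ρ t))|_{ρ = 1} = -δ/2 < 0` (the disc leaves `D_k` transversally:
  the clock `G_k(θ(s, ·)) = 1 + s`);
* `helper_friendsCarrier_Tk_coreDisc` — the registered summary: GERM + CORE-DISC clauses of
  `helper_friendsCarrier_Tk` for `(T, incl, coreDisc, collarGerm)`, with the chart interface.

Everything is proved; the definitions are constructions, not named facts; no `sorry`.
References: Kirby, *The Topology of 4-Manifolds* (1989), Ch. I §2 [Kirby1989]; Manolescu–Piccirillo (2023),
§3.2, proof of Lemma 3.3 [ManolescuPiccirillo2023].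
-/

-- the prescribed namespace `Summit.<P>.<Sub>.…` duplicates `SmoothPoincare4` (P = Sub)
set_option linter.dupNamespace false
set_option linter.style.longLine false

noncomputable section

open scoped Manifold ContDiff Topology
open Function Set Metric
open Literature.Topology.FourManifolds Literature.Topology.FourManifolds.MMSW

namespace Summit.SmoothPoincare4.SmoothPoincare4.Theorems.DcrGap.MkFriends

namespace FriendsTk

namespace TraceDatum

variable {k : ℕ} (D : TraceDatum k)

/-! ### The core disc of the `2`-handle -/

/-- **The core disc of the `2`-handle**, extended to the whole core plane: `x ↦ inr (x, 0)`.
[cite: Kirby1989, Ch. I §2] -/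
def coreDisc (x : EuclideanSpace ℝ (Fin 2)) : D.Trace := D.trGlueData.inr (x, 0)

/-- Unfolding of `coreDisc`. [folklore] -/
theorem coreDisc_apply (x : EuclideanSpace ℝ (Fin 2)) : D.coreDisc x = D.trGlueData.inr (x, 0) := rfl

/-- Off the centre the core disc lies in the `0`-handle chart: `coreDisc x = incl (bwd (x, 0))`.
[folklore] -/
theorem coreDisc_eq_incl {x : EuclideanSpace ℝ (Fin 2)} (hx : x ≠ 0) : D.coreDisc x = D.incl (D.bwd (x, 0)) :=
  D.inr_eq_incl_bwd (p := (x, 0)) hx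

/-- `s(1) = 0`. [folklore] -/
theorem collarTime_one : D.collarTime 1 = 0 := by simp [collarTime]

/-- **The boundary of the core disc is the knot**: `coreDisc u = incl (ν(u, 0))` for `u ∈ 𝕊¹`.
[cite: Kirby1989, Ch. I §2] -/
theorem coreDisc_coe_sphere (u : Metric.sphere (0 : EuclideanSpace ℝ (Fin 2)) 1) :
    D.coreDisc u = D.incl (D.νK (u, 0)) := by
  rw [D.coreDisc_eq_incl (ne_zero_of_mem_unit_sphere u)]
  congr 1
  have : ((u : EuclideanSpace ℝ (Fin 2)), (0 : EuclideanSpace ℝ (Fin 2))) =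
      ((1 : ℝ) • (u : EuclideanSpace ℝ (Fin 2)), (0 : EuclideanSpace ℝ (Fin 2))) := by rw [one_smul]
  rw [this, D.bwd_smul one_pos, D.collarTime_one, D.θ_zero]

/-- The core disc is smooth. [folklore] -/
theorem contMDiff_coreDisc : ContMDiff (𝓡 2) (𝓡 4) ∞ D.coreDisc := by
  have h : ContMDiff 𝓘(ℝ, EuclideanSpace ℝ (Fin 2)) 𝓘(ℝ, (EuclideanSpace ℝ (Fin 2)) × (EuclideanSpace ℝ (Fin 2))) ∞
      fun x : EuclideanSpace ℝ (Fin 2) ↦ (x, (0 : EuclideanSpace ℝ (Fin 2))) :=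
    (contDiff_id.prodMk contDiff_const).contMDiff
  exact D.trGlueData.contMDiff_inr.comp h

/-- The core disc is injective. [folklore] -/
theorem injective_coreDisc : Injective D.coreDisc := fun x y h ↦ by
  have := D.trGlueData.inr_injective h
  simpa using this

/-- The core disc is an immersion. [folklore] -/
theorem injective_mfderiv_coreDisc (x : EuclideanSpace ℝ (Fin 2)) : Injective (mfderiv (𝓡 2) (𝓡 4) D.coreDisc x) := by
  have hn : (∞ : ℕ∞ω) ≠ 0 := by simp
  let ι : (EuclideanSpace ℝ (Fin 2)) →L[ℝ] (EuclideanSpace ℝ (Fin 2)) × (EuclideanSpace ℝ (Fin 2)) :=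
    ContinuousLinearMap.inl ℝ (EuclideanSpace ℝ (Fin 2)) (EuclideanSpace ℝ (Fin 2))
  have hcd : D.coreDisc = D.trGlueData.inr ∘ ι := by
    funext x; simp [coreDisc_apply, ι]
  rw [hcd, mfderiv_comp x (D.trGlueData.contMDiff_inr.mdifferentiableAt hn) ι.hasMFDerivAt.mdifferentiableAt,
    ι.mfderiv_eq]
  intro v w hvw
  have h1 : ι v = ι w := D.injective_mfderiv_inr (ι x) hvw
  have h2 : @Eq (EuclideanSpace ℝ (Fin 2)) v w := by simpa [ι] using h1
  exact h2

/-- **The open core disc misses the handlebody**: for `‖x‖ < 1`, `coreDisc x ∉ incl(D_k)` (its centre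
lies on the cocore plane; off the centre it is `incl (θ(s, K₀ u))` with `s > 0`, outside `D_k`).
[cite: ManolescuPiccirillo2023, §3.2, proof of Lemma 3.3] -/
theorem coreDisc_not_mem {x : EuclideanSpace ℝ (Fin 2)} (hx : ‖x‖ < 1) : D.coreDisc x ∉ D.incl '' modelHandlebody k := by
  rintro ⟨y, hy, hxy⟩
  by_cases hx0 : x = 0
  · subst hx0
    have : D.trGlueData.inr ((0 : EuclideanSpace ℝ (Fin 2)), (0 : EuclideanSpace ℝ (Fin 2))) ∈ D.incl '' D.hbNbhd :=
      ⟨y, D.modelHandlebody_subset_hbNbhd hy, hxy⟩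
    rw [D.inr_mem_image_incl_iff] at this
    exact this rfl
  · rw [D.coreDisc_eq_incl hx0] at hxy
    have hyeq : y = D.bwd (x, 0) :=
      D.injOn_incl (D.modelHandlebody_subset_hbNbhd hy) (D.bwd_mem_hbNbhd (p := (x, 0)) hx0) hxy
    have hpos : 0 < ‖x‖ := norm_pos_iff.2 hx0
    have hs := D.collarTime_mem_Ioo hpos
    have hle : D.collarTime ‖x‖ ≤ 0 :=
      (D.mem_modelHandlebody_iff _ (D.νK_mem (radialProjection (spherePt 1) x, 0)) _ hs).1 (by
        have : D.bwd (x, 0) ∈ modelHandlebody k := hyeq ▸ hy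
        exact this)
    rw [D.collarTime_nonpos_iff hpos.le] at hle
    linarith

/-! ### The collar germ of the core disc -/

/-- **The collar germ** `g₀ : ℝ² → ℝ⁴` of the core disc: `g₀ x = θ(δ(1 - ‖x‖)/(1 + ‖x‖), K₀(x/‖x‖))`
for `‖x‖² ≥ 1/2`, cut off smoothly to the constant `θ(0, 0)` near the origin. [folklore] -/
def collarGerm (x : EuclideanSpace ℝ (Fin 2)) : EuclideanSpace ℝ (Fin 4) :=
  D.θ (Real.smoothTransition (4 * ‖x‖ ^ 2 - 1) * D.collarTime ‖x‖,
    Real.smoothTransition (4 * ‖x‖ ^ 2 - 1) • D.νK (radialProjection (spherePt 1) x, 0))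

/-- On `‖x‖² ≥ 1/2` the collar germ is `bwd (x, 0)`. [folklore] -/
theorem collarGerm_eq_bwd {x : EuclideanSpace ℝ (Fin 2)} (hx : 1 / 2 ≤ ‖x‖ ^ 2) : D.collarGerm x = D.bwd (x, 0) := by
  have h1 : Real.smoothTransition (4 * ‖x‖ ^ 2 - 1) = 1 := Real.smoothTransition.one_of_one_le (by linarith)
  simp only [collarGerm, h1, one_mul, one_smul]
  rfl

/-- The collar germ is smooth. [folklore] -/
theorem contDiff_collarGerm : ContDiff ℝ ∞ D.collarGerm := by
  rw [contDiff_iff_contDiffAt]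
  intro x
  by_cases hx : x = 0
  · -- near the origin `g₀` is constant
    subst hx
    have hev : D.collarGerm =ᶠ[𝓝 (0 : EuclideanSpace ℝ (Fin 2))] fun _ => D.θ (0, 0) := by
      filter_upwards [Metric.ball_mem_nhds (0 : EuclideanSpace ℝ (Fin 2)) (show (0 : ℝ) < 1 / 2 by norm_num)] with x hx
      rw [Metric.mem_ball, dist_zero_right] at hx
      have h0 : Real.smoothTransition (4 * ‖x‖ ^ 2 - 1) = 0 :=
        Real.smoothTransition.zero_of_nonpos (by nlinarith [norm_nonneg x])
      simp only [collarGerm, h0, zero_mul, zero_smul]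
    exact (contDiffAt_const (c := D.θ (0, 0))).congr_of_eventuallyEq hev
  · have hχ : ContDiffAt ℝ ∞ (fun x : EuclideanSpace ℝ (Fin 2) => Real.smoothTransition (4 * ‖x‖ ^ 2 - 1)) x :=
      Real.smoothTransition.contDiffAt.comp x
        ((contDiffAt_const.mul ((contDiff_norm_sq ℝ).contDiffAt)).sub contDiffAt_const)
    have hn : ContDiffAt ℝ ∞ (fun x : EuclideanSpace ℝ (Fin 2) => ‖x‖) x := contDiffAt_norm ℝ hx
    have hT : ContDiffAt ℝ ∞ (fun x : EuclideanSpace ℝ (Fin 2) => D.collarTime ‖x‖) x := by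
      simp only [collarTime]
      exact (contDiffAt_const.mul (contDiffAt_const.sub hn)).div (contDiffAt_const.add hn) (by positivity)
    have hν : ContDiffAt ℝ ∞ (fun x : EuclideanSpace ℝ (Fin 2) => D.νK (radialProjection (spherePt 1) x, 0)) x := by
      have h1 : ContMDiffAt 𝓘(ℝ, EuclideanSpace ℝ (Fin 2)) ((𝓡 1).prod 𝓘(ℝ, EuclideanSpace ℝ (Fin 2))) ∞
          (fun x : EuclideanSpace ℝ (Fin 2) => (radialProjection (spherePt 1) x, (0 : EuclideanSpace ℝ (Fin 2)))) x :=
        (((contMDiffOn_radialProjection (spherePt 1)).contMDiffAt (isOpen_ne.mem_nhds hx))).prodMk contMDiffAt_const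
      exact ((D.contMDiff_νK _).comp x h1).contDiffAt
    exact D.contDiff_θ.contDiffAt.comp x ((hχ.mul hT).prodMk (hχ.smul hν))

/-- **The core disc runs along the collar germ near its boundary**: for `3/4 < ‖x‖ ≤ 1`,
`g₀ x ∈ P` and `coreDisc x = incl (g₀ x)`. [folklore] -/
theorem coreDisc_eq_incl_collarGerm {x : EuclideanSpace ℝ (Fin 2)} (h1 : 1 - 1 / 4 < ‖x‖) (_h2 : ‖x‖ ≤ 1) :
    D.collarGerm x ∈ D.hbNbhd ∧ D.coreDisc x = D.incl (D.collarGerm x) := by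
  have hx0 : x ≠ 0 := by
    intro h; rw [h, norm_zero] at h1; norm_num at h1
  have hsq : 1 / 2 ≤ ‖x‖ ^ 2 := by nlinarith
  rw [D.collarGerm_eq_bwd hsq]
  exact ⟨D.bwd_mem_hbNbhd (p := (x, 0)) hx0, D.coreDisc_eq_incl hx0⟩

/-- **The core disc leaves the handlebody transversally**: `d/dρ G_k(g₀(ρ t))|_{ρ=1} = -δ/2 < 0`
(the clock along the collar). [folklore] -/
theorem deriv_levelFun_collarGerm (t : Metric.sphere (0 : EuclideanSpace ℝ (Fin 2)) 1) :
    deriv (fun ρ : ℝ => levelFun k (D.collarGerm (ρ • (t : EuclideanSpace ℝ (Fin 2))))) 1 < 0 := by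
  -- near `ρ = 1` the function is `1 + δ (1 - ρ)/(1 + ρ)`
  have hev : (fun ρ : ℝ => levelFun k (D.collarGerm (ρ • (t : EuclideanSpace ℝ (Fin 2))))) =ᶠ[𝓝 (1 : ℝ)]
      fun ρ : ℝ => 1 + D.δ * ((1 - ρ) / (1 + ρ)) := by
    filter_upwards [Ioo_mem_nhds (show (3 : ℝ) / 4 < 1 by norm_num) (show (1 : ℝ) < 2 by norm_num)] with ρ hρ
    have hρ0 : 0 < ρ := by linarith [hρ.1]
    have hnorm : ‖ρ • (t : EuclideanSpace ℝ (Fin 2))‖ = ρ := norm_smul_coe_sphere hρ0.le t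
    have hsq : 1 / 2 ≤ ‖ρ • (t : EuclideanSpace ℝ (Fin 2))‖ ^ 2 := by rw [hnorm]; nlinarith [hρ.1]
    rw [D.collarGerm_eq_bwd hsq, D.bwd_smul hρ0, (D.clock_νK _ (D.collarTime_mem_Ioo hρ0)).2, collarTime,
      mul_div_assoc]
  rw [hev.deriv_eq]
  have h1 : HasDerivAt (fun ρ : ℝ => 1 - ρ) (-1) 1 := by simpa using (hasDerivAt_id (1 : ℝ)).const_sub 1
  have h2 : HasDerivAt (fun ρ : ℝ => 1 + ρ) 1 1 := by simpa using (hasDerivAt_id (1 : ℝ)).const_add 1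
  have h3 : HasDerivAt (fun ρ : ℝ => 1 + D.δ * ((1 - ρ) / (1 + ρ)))
      (D.δ * ((-1 * (1 + 1) - (1 - 1) * 1) / (1 + 1) ^ 2)) 1 :=
    ((h1.div h2 (by norm_num)).const_mul D.δ).const_add 1
  rw [h3.deriv]
  norm_num
  linarith [D.δ_pos]

end TraceDatum

end FriendsTk

/-- **Helper `helper_friendsCarrier_Tk_coreDisc`** (registered on the crux item; piece (3c) of the
relative open trace `T_k` of stub `helper_friendsCarrier_Tk`): for a tube `ν` of the model knot
`K₀ = ν(·, 0)` with collar flow and tube coordinates (pieces (1)–(2)), the relative open trace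
`T = P ∪_glue (ℝ² × ℝ²)` carries the GERM clauses (`i = incl` along `P = {G_k < 1 + δ} ⊇ D_k`) and the
CORE-DISC clauses of `helper_friendsCarrier_Tk` verbatim (`f₀` the core of the `2`-handle, `g₀` its
collar germ: smooth injective immersion on the closed disc, open disc off `i(D_k)`, boundary `i ∘ K₀`,
`f₀ = i ∘ g₀` near the boundary, `d/dρ G_k(g₀(ρ t))|₁ < 0`), together with the two-chart interface
(Kirby 1989, Ch. I §2; Manolescu–Piccirillo, proof of Lemma 3.3). [cite: Kirby1989, Ch. I §2] -/
theorem helper_friendsCarrier_Tk_coreDisc : ∀ (k : ℕ) (K₀ : (sphere (0 : EuclideanSpace ℝ (Fin 2)) 1) → EuclideanSpace ℝ (Fin 4)) (νK : (sphere (0 : EuclideanSpace ℝ (Fin 2)) 1) × EuclideanSpace ℝ (Fin 2) → EuclideanSpace ℝ (Fin 4)) (θ : ℝ × EuclideanSpace ℝ (Fin 4) → EuclideanSpace ℝ (Fin 4)) (δ : ℝ) (ι : EuclideanSpace ℝ (Fin 4) → (sphere (0 : EuclideanSpace ℝ (Fin 2)) 1) × EuclideanSpace ℝ (Fin 2)),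 (∀ u, νK (u, 0) = K₀ u) → 0 < δ → δ < 1 → ContDiff ℝ ((⊤ : ℕ∞) : WithTop ℕ∞) θ → (∀ x, θ (0, x) = x) → (∀ t s x, θ (t, θ (s, x)) = θ (t + s, x)) → (∀ y : EuclideanSpace ℝ (Fin 4), (∀ j, (1 : ℝ) / 2 < holeTerm k j y) → levelFun k y ∈ Ioo (1 - δ) (1 + δ) → ∀ t : ℝ, levelFun k y + t ∈ Ioo (1 - δ) (1 + δ) → (∀ j, (1 : ℝ) / 2 < holeTerm k j (θ (t, y))) ∧ levelFun k (θ (t, y)) = levelFun k y + t) → (∀ a ∈ modelBoundary k, ∀ s ∈ Ioo (-δ) δ, (θ (s, a) ∈ modelHandlebody k ↔ s ≤ 0)) → ContMDiff ((𝓡 1).prod 𝓘(ℝ, EuclideanSpace ℝ (Fin 2))) 𝓘(ℝ, EuclideanSpace ℝ (Fin 4)) ((⊤ : ℕ∞) : WithTop ℕ∞) νK → (∀ p, νK p ∈ modelBoundary k) → IsOpen {y : EuclideanSpace ℝ (Fin 4) | (∀ j, (1 : ℝ) / 2 < holeTerm k j y) ∧ levelFun k y ∈ Ioo (1 - δ)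 (1 + δ) ∧ θ (1 - levelFun k y, y) ∈ range νK} → ContMDiffOn 𝓘(ℝ, EuclideanSpace ℝ (Fin 4)) ((𝓡 1).prod 𝓘(ℝ, EuclideanSpace ℝ (Fin 2))) ((⊤ : ℕ∞) : WithTop ℕ∞) ι {y : EuclideanSpace ℝ (Fin 4) | (∀ j, (1 : ℝ) / 2 < holeTerm k j y) ∧ levelFun k y ∈ Ioo (1 - δ) (1 + δ) ∧ θ (1 - levelFun k y, y) ∈ range νK} → (∀ (q : (sphere (0 : EuclideanSpace ℝ (Fin 2)) 1) × EuclideanSpace ℝ (Fin 2)) (s : ℝ), s ∈ Ioo (-δ) δ → ι (θ (s, νK q)) = q) → (∀ y ∈ {y : EuclideanSpace ℝ (Fin 4) | (∀ j, (1 : ℝ) / 2 < holeTerm k j y) ∧ levelFun k y ∈ Ioo (1 - δ) (1 + δ) ∧ θ (1 - levelFun k y, y) ∈ range νK}, θ (levelFun k y - 1, νK (ι y)) = y) → ∃ (X : Type) (_ : TopologicalSpace X) (_ : T2Space X) (_ : ChartedSpace (EuclideanSpace ℝ (Fin 4)) X) (_ : IsManifold (𝓡 4) ((⊤ : ℕ∞)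 : WithTop ℕ∞) X) (i : EuclideanSpace ℝ (Fin 4) → X) (h : EuclideanSpace ℝ (Fin 2) × EuclideanSpace ℝ (Fin 2) → X) (f₀ : EuclideanSpace ℝ (Fin 2) → X) (g₀ : EuclideanSpace ℝ (Fin 2) → EuclideanSpace ℝ (Fin 4)), (IsOpen {y : EuclideanSpace ℝ (Fin 4) | (∀ j, (1 : ℝ) / 2 < holeTerm k j y) ∧ levelFun k y < 1 + δ} ∧ modelHandlebody k ⊆ {y : EuclideanSpace ℝ (Fin 4) | (∀ j, (1 : ℝ) / 2 < holeTerm k j y) ∧ levelFun k y < 1 + δ} ∧ ContMDiffOn (𝓡 4) (𝓡 4) ((⊤ : ℕ∞) : WithTop ℕ∞) i {y : EuclideanSpace ℝ (Fin 4) | (∀ j, (1 : ℝ) / 2 < holeTerm k j y) ∧ levelFun k y < 1 + δ} ∧ InjOn i {y : EuclideanSpace ℝ (Fin 4) | (∀ j, (1 : ℝ) / 2 < holeTerm k j y) ∧ levelFun k y < 1 + δ} ∧ (∀ x ∈ {y : EuclideanSpace ℝ (Fin 4) | (∀ j, (1 : ℝ) / 2 < holeTerm k j y) ∧ levelFun k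 y < 1 + δ}, Injective (mfderiv (𝓡 4) (𝓡 4) i x))) ∧ (ContMDiff (𝓡 2) (𝓡 4) ((⊤ : ℕ∞) : WithTop ℕ∞) f₀ ∧ InjOn f₀ (closedBall (0 : EuclideanSpace ℝ (Fin 2)) 1) ∧ (∀ x ∈ closedBall (0 : EuclideanSpace ℝ (Fin 2)) 1, Injective (mfderiv (𝓡 2) (𝓡 4) f₀ x)) ∧ (∀ x : EuclideanSpace ℝ (Fin 2), ‖x‖ < 1 → f₀ x ∉ i '' modelHandlebody k) ∧ (∀ t : (sphere (0 : EuclideanSpace ℝ (Fin 2)) 1), f₀ t = i (K₀ t)) ∧ ContDiff ℝ ((⊤ : ℕ∞) : WithTop ℕ∞) g₀ ∧ (∃ η : ℝ, 0 < η ∧ (∀ x : EuclideanSpace ℝ (Fin 2), 1 - η < ‖x‖ → ‖x‖ ≤ 1 → g₀ x ∈ {y : EuclideanSpace ℝ (Fin 4) | (∀ j, (1 : ℝ) / 2 < holeTerm k j y) ∧ levelFun k y < 1 + δ} ∧ f₀ x = i (g₀ x))) ∧ (∀ t : (sphere (0 : EuclideanSpace ℝ (Fin 2)) 1), deriv (fun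 ρ : ℝ => levelFun k (g₀ (ρ • (t : EuclideanSpace ℝ (Fin 2))))) 1 < 0)) ∧ (∀ x, f₀ x = h (x, 0)) ∧ i '' {y : EuclideanSpace ℝ (Fin 4) | (∀ j, (1 : ℝ) / 2 < holeTerm k j y) ∧ levelFun k y < 1 + δ} ∪ range h = univ ∧ (∀ y ∈ {y : EuclideanSpace ℝ (Fin 4) | (∀ j, (1 : ℝ) / 2 < holeTerm k j y) ∧ levelFun k y < 1 + δ}, ∀ p : EuclideanSpace ℝ (Fin 2) × EuclideanSpace ℝ (Fin 2), i y = h p ↔ p.1 ≠ 0 ∧ θ (δ * (1 - ‖p.1‖) / (1 + ‖p.1‖), νK (radialProjection (spherePt 1) p.1, p.2)) = y) := by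
  intro k K₀ νK θ δ ι hK hδ hδ1 hθ h0 hadd hclock hiff hν hmem hopen hι hιθ hθι
  let D : FriendsTk.TraceDatum k := ⟨νK, θ, δ, ι, hδ, hδ1, hθ, h0, hadd, hclock, hiff, hν, hmem, hopen, hι, hιθ, hθι⟩
  refine ⟨D.Trace, inferInstance, inferInstance, inferInstance, inferInstance, D.incl, D.trGlueData.inr, D.coreDisc,
    D.collarGerm, ⟨D.isOpen_hbNbhd, D.modelHandlebody_subset_hbNbhd, D.contMDiffOn_incl, D.injOn_incl,
      fun x hx => D.injective_mfderiv_incl hx⟩,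
    ⟨D.contMDiff_coreDisc, D.injective_coreDisc.injOn, fun x _ => D.injective_mfderiv_coreDisc x,
      fun x hx => D.coreDisc_not_mem hx, fun t => ?_, D.contDiff_collarGerm,
      ⟨1 / 4, by norm_num, fun x h1 h2 => D.coreDisc_eq_incl_collarGerm h1 h2⟩, D.deriv_levelFun_collarGerm⟩,
    fun x => rfl, D.image_incl_union_range_inr, fun y hy p => D.incl_eq_inr_iff hy⟩
  exact (D.coreDisc_coe_sphere t).trans (congrArg D.incl (hK t))

end Summit.SmoothPoincare4.SmoothPoincare4.Theorems.DcrGap.MkFriends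

end
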